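import Literature.Analysis.Calculus.RadiiPolynomialTwoRadii
import HarnessLib

/-!
# Radii polynomials for AFFINE maps: injectivity from `‖I − A∘B‖ < 1` and GLOBAL uniqueness

`Literature/Analysis/Calculus`; proofs-layer companion of `RadiiPolynomial.lean` (theorems only; no
definitions, no named facts).

For an AFFINE problem `F(x) = Bx + c` the derivative is the constant operator `B`, the bound
`‖I − A∘B‖ ≤ Z < 1` of `existsUnique_zero_of_newtonLike` (form (1) of `RadiiPolynomial.lean`; e.g.
`Z = Z₀ + Z₁` with `Z₂ = 0` in the `Y₀/Z₀/Z₁/Z₂` form) holds on ALL of `X`, and the contraction estimate of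
the printed proof is global: two zeros `z₁, z₂` of `F` anywhere in `X` satisfy `A B (z₁ − z₂) = 0`, i.e.
`z₁ − z₂ = (I − A∘B)(z₁ − z₂)`, hence `‖z₁ − z₂‖ ≤ Z ‖z₁ − z₂‖` and `z₁ = z₂`.  This is the injectivity
half of the step «`Z < 1` … hence `A DF(ū)` is invertible. From this we get that `A` is invertible» closing
the printed proof of [cite: ConstantineauGarciaAzpeitiaLessard2021, Thm 3.1] (arXiv:2107.05118 p. 8; quoted
in `RadiiPolynomialTwoRadii.lean`), equivalently Cor. 9 of [CallejaEtAl2021] (= the tree's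
`isInvertible_comp_of_newtonLike`), and it needs neither completeness of `X` nor finite dimension.

Typed 2026-08-27 for the certnum F2 (A) request («F is AFFINE; Z₀ + Z₁ < 1 makes AF — hence F — injective
on all of X (global uniqueness for affine maps), and F(truth) = 0 because the truth zeroes EVERY level ⇒ the
unique zero enclosed IS [the planted solution]»): a planted / manufactured solution which zeroes an affine
`F` EXACTLY is THE zero that `existsUnique_zero_of_newtonLike` encloses, wherever in `X` it lies.

Contents: `hasFDerivAt_of_affine` (`F x − F y = B(x − y)` ⇒ `DF ≡ B`), `injective_comp_of_norm_id_sub_lt`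
(`‖I − A∘B‖ < 1 ⇒ A∘B` injective), `injective_of_norm_id_sub_comp_lt` (`⇒ B` injective),
`injective_of_affine_of_norm_id_sub_comp_lt`, `eq_of_zero_of_zero_of_affine` (GLOBAL uniqueness),
`existsUnique_zero_of_newtonLike_affine` (form (1) for affine `F`: a zero in `B̄_r(x̄)`, every zero in `X`
equals it, Newton-like iterates converge), `existsUnique_zero_of_newtonLike_affine_of_le` (the same with the
NON-STRICT closing `Z < 1`, `Y₀ + Z r ≤ r` — the lines a cap-nk/1 `contraction` certificate checks,
`RadiiPolynomialCertificate.ContractionCert.check`), and the `Y₀/Z₀/Z₁` packaging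
`norm_id_sub_comp_le_of_Z₀_Z₁` (`‖I − A∘B‖ ≤ Z₀ + Z₁`, [LessardMirelesJames2017] (4)–(5), (58) with `Z₂ = 0`),
`existsUnique_zero_of_radiiPolynomial_affine`; and the client's own shape `existsUnique_affine_zero_of_norm_id_sub_le`
(`‖I − M‖ ≤ Z < 1 ⇒ M x = c` has exactly one solution `x⋆ ∈ X` and `‖x⋆ − x̄‖ ≤ ‖M x̄ − c‖/(1 − Z)`).

## References
* K. Constantineau, C. García-Azpeitia, J.-P. Lessard, *Spatial relative equilibria and periodic solutions of
  the Coulomb (n+1)-body problem*, Qual. Theory Dyn. Syst. 20 (2021), arXiv:2107.05118 — Thm 3.1 and the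
  last step of its proof (p. 8). [cite: ConstantineauGarciaAzpeitiaLessard2021, Thm 3.1]
* A. Hungria, J.-P. Lessard, J. D. Mireles James, Math. Comp. 85 (2016) 1427–1459 — §3 Prop. 1 (form (1)).
  [cite: HungriaLessardMirelesJames2016, §3 Prop. 1]
* R. Calleja, C. García-Azpeitia, J.-P. Lessard, J. D. Mireles James, Nonlinearity 34 (2021) 313–348 — Cor. 9.
* J.-P. Lessard, J. D. Mireles James, SIAM J. Math. Anal. 49 (2017) 530–561 — Thm 1.5, bounds (4)–(5), proof
  eq. (58). [cite: LessardMirelesJames2017, Thm 1.5]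
-/

noncomputable section

open Metric Set Filter
open scoped Topology

namespace Literature.Analysis.Calculus

variable {X Y : Type*} [NormedAddCommGroup X] [NormedSpace ℝ X]
  [NormedAddCommGroup Y] [NormedSpace ℝ Y]

section Affine


/-- From `F x − F y = B (x − y)` for all `x, y`: `F = B + F 0`, so `F` has Fréchet derivative `B` everywhere
(elementary; recorded so that clients can feed `F' := fun _ ↦ B` to the hypothesis «`F` Fréchet differentiable
with `DF(x)`» of the printed theorem and of `RadiiPolynomialCertificate.*.sound`).
[cite: ConstantineauGarciaAzpeitiaLessard2021, Thm 3.1 (hypothesis «Fréchet differentiable mapping F», affine case)] -/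
theorem hasFDerivAt_of_affine {F : X → Y} {B : X →L[ℝ] Y}
    (hF : ∀ x y, F x - F y = B (x - y)) (x : X) : HasFDerivAt F B x := by
  have hrepr : F = fun z => B z + F 0 := by
    funext z
    have h := hF z 0
    rw [sub_zero] at h
    exact eq_add_of_sub_eq h
  rw [hrepr]
  exact B.hasFDerivAt.add_const (F 0)

/-- **Injectivity half of the Neumann-series step** («`Z < 1` … hence `A DF(ū)` is invertible»): if
`‖I − A∘B‖ < 1` then `A ∘ B` is injective — for `x` with `A B x = 0` one has `x = (I − A∘B) x`, so
`‖x‖ ≤ ‖I − A∘B‖ ‖x‖` forces `x = 0`.  No completeness of `X` is needed (the tree's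
`isInvertible_comp_of_norm_id_sub_lt` gives invertibility when `X` is complete).
[cite: ConstantineauGarciaAzpeitiaLessard2021, Thm 3.1 (proof, last step)] -/
theorem injective_comp_of_norm_id_sub_lt {A : Y →L[ℝ] X} {B : X →L[ℝ] Y}
    (h : ‖ContinuousLinearMap.id ℝ X - A.comp B‖ < 1) : Function.Injective (A.comp B) := by
  refine (injective_iff_map_eq_zero _).2 fun x hx => ?_
  have h1 : (ContinuousLinearMap.id ℝ X - A.comp B) x = x := by
    rw [sub_apply, hx, sub_zero, ContinuousLinearMap.id_apply]
  have h2 : ‖x‖ ≤ ‖ContinuousLinearMap.id ℝ X - A.comp B‖ * ‖x‖ := by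
    conv_lhs => rw [← h1]
    exact ContinuousLinearMap.le_opNorm _ _
  by_contra hne
  have hpos : 0 < ‖x‖ := norm_pos_iff.2 hne
  nlinarith

/-- `‖I − A∘B‖ < 1 ⇒ B` injective («hence `DF(ū)` is injective»; with `A` injective this is the
non-degeneracy clause of the printed theorem, without completeness).
[cite: ConstantineauGarciaAzpeitiaLessard2021, Thm 3.1 (proof, last step)] -/
theorem injective_of_norm_id_sub_comp_lt {A : Y →L[ℝ] X} {B : X →L[ℝ] Y}
    (h : ‖ContinuousLinearMap.id ℝ X - A.comp B‖ < 1) : Function.Injective B := by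
  intro x y hxy
  exact injective_comp_of_norm_id_sub_lt h (by simp only [ContinuousLinearMap.coe_comp,
    Function.comp_apply, hxy])

/-- **Global uniqueness for AFFINE maps**: if `F x − F y = B (x − y)` for all `x, y` (any affine
presentation `F = B · + c`) and `‖I − A∘B‖ < 1` for some bounded linear `A : Y → X`, then `F` is injective
on ALL of `X` — the printed contraction/Neumann step with the constant derivative `DF ≡ B`, so the ball
plays no role. [cite: ConstantineauGarciaAzpeitiaLessard2021, Thm 3.1 (proof, last step; affine case)] -/
theorem injective_of_affine_of_norm_id_sub_comp_lt {F : X → Y} {A : Y →L[ℝ] X} {B : X →L[ℝ] Y}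
    (hF : ∀ x y, F x - F y = B (x - y)) (h : ‖ContinuousLinearMap.id ℝ X - A.comp B‖ < 1) :
    Function.Injective F := by
  intro x y hxy
  have hB : B (x - y) = 0 := by rw [← hF, hxy, sub_self]
  have hxy0 : x - y = 0 := injective_of_norm_id_sub_comp_lt h (by rw [hB, map_zero])
  exact sub_eq_zero.1 hxy0

/-- **Two zeros of an affine `F` anywhere in `X` coincide** when `‖I − A∘B‖ < 1` (`B` = the linear part):
the form in which a certificate client uses it («the truth zeroes every equation ⇒ the unique zero enclosed
IS the truth»). [cite: ConstantineauGarciaAzpeitiaLessard2021, Thm 3.1 (proof, last step; affine case)] -/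
theorem eq_of_zero_of_zero_of_affine {F : X → Y} {A : Y →L[ℝ] X} {B : X →L[ℝ] Y}
    (hF : ∀ x y, F x - F y = B (x - y)) (h : ‖ContinuousLinearMap.id ℝ X - A.comp B‖ < 1)
    {z₁ z₂ : X} (hz₁ : F z₁ = 0) (hz₂ : F z₂ = 0) : z₁ = z₂ :=
  injective_of_affine_of_norm_id_sub_comp_lt hF h (by rw [hz₁, hz₂])

/-- **Radii-polynomial theorem, form (1), for an AFFINE `F`** (`F x − F y = B (x − y)`): under the
hypotheses of `existsUnique_zero_of_newtonLike` with the constant derivative `B` — `A` injective,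
`‖A F(x̄)‖ ≤ Y₀`, `‖I − A∘B‖ ≤ Z`, `Y₀ + Z r < r` — `F` has a zero `x⋆ ∈ B̄_r(x̄)`, EVERY zero of `F` in the
whole space `X` equals `x⋆` (not only those in the ball), and the Newton-like iterates from `x̄` converge to
`x⋆`.  [cite: HungriaLessardMirelesJames2016, §3 Prop. 1]
[cite: ConstantineauGarciaAzpeitiaLessard2021, Thm 3.1 (proof, last step; affine case)] -/
theorem existsUnique_zero_of_newtonLike_affine [CompleteSpace X] {F : X → Y} {B : X →L[ℝ] Y}
    {xbar : X} {A : Y →L[ℝ] X} {Y₀ Z r : ℝ} (hr : 0 ≤ r) (hA : Function.Injective A)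
    (hF : ∀ x y, F x - F y = B (x - y)) (hY : ‖A (F xbar)‖ ≤ Y₀)
    (hZ : ‖ContinuousLinearMap.id ℝ X - A.comp B‖ ≤ Z) (h : Y₀ + Z * r < r) :
    ∃ x ∈ closedBall xbar r, F x = 0 ∧ (∀ y : X, F y = 0 → y = x) ∧
      Tendsto (fun n => (newtonLikeMap A F)^[n] xbar) atTop (𝓝 x) := by
  obtain ⟨x, hx, hfx, -, htend⟩ := existsUnique_zero_of_newtonLike (F' := fun _ => B) hr hA
    (fun z _ => hasFDerivAt_of_affine hF z) hY (fun _ _ => hZ) h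
  have hY₀ : 0 ≤ Y₀ := (norm_nonneg _).trans hY
  have hZ1 : Z < 1 := by
    by_contra hZ1
    have hZ1' : 1 ≤ Z := not_lt.mp hZ1
    have : r ≤ Z * r := by nlinarith
    linarith
  exact ⟨x, hx, hfx, fun y hy => eq_of_zero_of_zero_of_affine hF (hZ.trans_lt hZ1) hy hfx, htend⟩

/-- **Form (1) for an AFFINE `F`, NON-STRICT closing** (the transcript lines of a cap-nk/1 `contraction`
certificate: `0 ≤ r`, `Z < 1`, `Y₀ + Z r ≤ r`; `r = 0` allowed): a zero `x⋆ ∈ B̄_r(x̄)`, EVERY zero of `F` in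
`X` equals `x⋆`, and the Newton-like iterates converge to `x⋆` — `existsUnique_zero_of_newtonLike_twoRadii_of_le`
at `r₀ = r* = r` with the constant derivative `B`, plus global uniqueness.
[cite: ConstantineauGarciaAzpeitiaLessard2021, Thm 3.1 (non-strict closing; proof, last step; affine case)] -/
theorem existsUnique_zero_of_newtonLike_affine_of_le [CompleteSpace X] {F : X → Y} {B : X →L[ℝ] Y}
    {xbar : X} {A : Y →L[ℝ] X} {Y₀ Z r : ℝ} (hr : 0 ≤ r) (hA : Function.Injective A)
    (hF : ∀ x y, F x - F y = B (x - y)) (hY : ‖A (F xbar)‖ ≤ Y₀)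
    (hZ : ‖ContinuousLinearMap.id ℝ X - A.comp B‖ ≤ Z) (hZ1 : Z < 1) (h : Y₀ + Z * r ≤ r) :
    ∃ x ∈ closedBall xbar r, F x = 0 ∧ (∀ y : X, F y = 0 → y = x) ∧
      Tendsto (fun n => (newtonLikeMap A F)^[n] xbar) atTop (𝓝 x) := by
  obtain ⟨x, hx, hfx, -, htend⟩ := existsUnique_zero_of_newtonLike_twoRadii_of_le (F' := fun _ => B)
    hr le_rfl hA (fun z _ => hasFDerivAt_of_affine hF z) hY (fun _ _ => hZ) hZ1 h
  exact ⟨x, hx, hfx, fun y hy => eq_of_zero_of_zero_of_affine hF (hZ.trans_lt hZ1) hy hfx, htend⟩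

/-- `‖I − A∘B‖ ≤ Z₀ + Z₁` from the two printed bounds `‖I − A A†‖ ≤ Z₀` (4) and `‖A[DF(x̄) − A†]‖ ≤ Z₁` (5)
when `DF ≡ B` (affine `F`: the `Z₂`-term of (58) «`‖I − A DF‖ ≤ Z₀ + Z₁ + Z₂ r`» vanishes):
`I − A∘B = (I − A∘A†) − A∘(B − A†)`. [cite: LessardMirelesJames2017, Thm 1.5 (4)–(5) and (58), case Z₂ = 0] -/
theorem norm_id_sub_comp_le_of_Z₀_Z₁ {A : Y →L[ℝ] X} {B Adag : X →L[ℝ] Y} {Z₀ Z₁ : ℝ}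
    (hZ₀ : ‖ContinuousLinearMap.id ℝ X - A.comp Adag‖ ≤ Z₀) (hZ₁ : ‖A.comp (B - Adag)‖ ≤ Z₁) :
    ‖ContinuousLinearMap.id ℝ X - A.comp B‖ ≤ Z₀ + Z₁ := by
  have hsplit : ContinuousLinearMap.id ℝ X - A.comp B
      = (ContinuousLinearMap.id ℝ X - A.comp Adag) - A.comp (B - Adag) := by
    rw [ContinuousLinearMap.comp_sub]; abel
  rw [hsplit]
  exact (norm_sub_le _ _).trans (add_le_add hZ₀ hZ₁)

/-- **`Y₀/Z₀/Z₁` form for an AFFINE `F`** (the quadratic radii polynomial with `Z₂ = 0`): `A` injective,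
`F x − F y = B (x − y)`, `‖A F(x̄)‖ ≤ Y₀`, `‖I − A A†‖ ≤ Z₀`, `‖A(B − A†)‖ ≤ Z₁`, `Y₀ + (Z₀ + Z₁) r < r`
(`r ≥ 0`) ⇒ a zero `x⋆ ∈ B̄_r(x̄)`, EVERY zero of `F` in `X` equals `x⋆`, Newton-like iterates converge.
[cite: LessardMirelesJames2017, Thm 1.5 (case Z₂ = 0)]
[cite: ConstantineauGarciaAzpeitiaLessard2021, Thm 3.1 (proof, last step; affine case)] -/
theorem existsUnique_zero_of_radiiPolynomial_affine [CompleteSpace X] {F : X → Y} {B Adag : X →L[ℝ] Y}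
    {xbar : X} {A : Y →L[ℝ] X} {Y₀ Z₀ Z₁ r : ℝ} (hr : 0 ≤ r) (hA : Function.Injective A)
    (hF : ∀ x y, F x - F y = B (x - y)) (hY : ‖A (F xbar)‖ ≤ Y₀)
    (hZ₀ : ‖ContinuousLinearMap.id ℝ X - A.comp Adag‖ ≤ Z₀) (hZ₁ : ‖A.comp (B - Adag)‖ ≤ Z₁)
    (h : Y₀ + (Z₀ + Z₁) * r < r) :
    ∃ x ∈ closedBall xbar r, F x = 0 ∧ (∀ y : X, F y = 0 → y = x) ∧
      Tendsto (fun n => (newtonLikeMap A F)^[n] xbar) atTop (𝓝 x) :=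
  existsUnique_zero_of_newtonLike_affine hr hA hF hY (norm_id_sub_comp_le_of_Z₀_Z₁ hZ₀ hZ₁) h

/-- **The shape a certificate client states** (certnum-ode-2, F2 (A), 2026-08-27: «G(x) = Mx − c with M bounded,
`‖I − M‖ ≤ Z < 1` … (i) G has a unique zero x⋆ in X; (ii) for any x̄, `‖x⋆ − x̄‖ ≤ ‖G(x̄)‖/(1 − Z)`»): for a
bounded `M : X → X` on a real Banach space with `‖I − M‖ ≤ Z < 1` and any `c, x̄ ∈ X`, the affine equation
`M x = c` has exactly one solution `x⋆ ∈ X`, and `‖x⋆ − x̄‖ ≤ ‖M x̄ − c‖ / (1 − Z)` — form (1) with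
`A = I`, `F = G`, `Y₀ = ‖G(x̄)‖`, `r = Y₀/(1 − Z)` (the canonical `r_min` of a `contraction` certificate,
non-strict closing with equality), plus global uniqueness.
[cite: ConstantineauGarciaAzpeitiaLessard2021, Thm 3.1 (A = I, affine case, r = Y/(1 − Z))] -/
theorem existsUnique_affine_zero_of_norm_id_sub_le [CompleteSpace X] (M : X →L[ℝ] X) (c xbar : X)
    {Z : ℝ} (hZ : ‖ContinuousLinearMap.id ℝ X - M‖ ≤ Z) (hZ1 : Z < 1) :
    ∃ xstar : X, M xstar = c ∧ (∀ y : X, M y = c → y = xstar) ∧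
      ‖xstar - xbar‖ ≤ ‖M xbar - c‖ / (1 - Z) := by
  set Y₀ : ℝ := ‖M xbar - c‖ with hY₀
  have h1Z : 0 < 1 - Z := sub_pos.2 hZ1
  have hr : 0 ≤ Y₀ / (1 - Z) := div_nonneg (norm_nonneg _) h1Z.le
  have hclose : Y₀ + Z * (Y₀ / (1 - Z)) ≤ Y₀ / (1 - Z) := by
    rw [show Y₀ + Z * (Y₀ / (1 - Z)) = Y₀ / (1 - Z) by field_simp; ring]
  have hF : ∀ x y : X, (M x - c) - (M y - c) = M (x - y) := fun x y => by
    rw [map_sub]; abel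
  have hZ' : ‖ContinuousLinearMap.id ℝ X - (ContinuousLinearMap.id ℝ X).comp M‖ ≤ Z := by
    rwa [ContinuousLinearMap.id_comp]
  have hY : ‖(ContinuousLinearMap.id ℝ X) (M xbar - c)‖ ≤ Y₀ := by
    rw [ContinuousLinearMap.id_apply]
  obtain ⟨x, hx, hfx, huniq, -⟩ := existsUnique_zero_of_newtonLike_affine_of_le
    (F := fun x => M x - c) (B := M) (A := ContinuousLinearMap.id ℝ X) hr
    (fun a b h => h) hF hY hZ' hZ1 hclose
  exact ⟨x, sub_eq_zero.1 hfx, fun y hy => huniq y (sub_eq_zero.2 hy), mem_closedBall_iff_norm.1 hx⟩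

end Affine

end Literature.Analysis.Calculus

end
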